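import Mathlib
import Summits.KontsevichZagierPeriods.Zeta5Search.Families.GapRegimeCT
import HarnessLib

/-!
# ζ(5) search — Families: lemmas for the gauge move — the functional `Phi`, chord spans, positions in `Frac ℤ[g]`

HONEST FRAMING: systematic search; no irrationality claim unless certified.  Cell `pub-zeta5`, seat P2 g10 (Families
layer), 2026-08-23.  Finite identities between integer polynomials; nothing about any zeta value; no record moves; no
conjecture node is used.

The `ℤ`-linear functional `Phi c L : MvPolynomial (Fin (M+1)) ℤ →+ ℤ`, `Phi c L P = Σ_d [g^d]P · E (d − L) c`
(`Families/GapRegimeCT`: `E` = regime constant term of `g^a ∏_i T_i^{−c_i}`, `T_i = g_i + ⋯ + g_M` the suffix sums,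
regime `g₀ ≫ ⋯ ≫ g_M`; `L` an offset so that negative `g`-exponents never occur).  Kernel content:
* `Phi_monomial`, `Phi_zero_eq_coeff : Phi 0 L P = [g^L] P` (no denominators = honest coefficient extraction);
* `Phi_mul_X : Phi c (L + δ_v) (P · g_v) = Phi c L P`, `Phi_mul_monomial` (offset shifts);
* **`Phi_mul_T : Phi c L (P · T_i) = Phi (c − δ_i) L P`** (the key lemma `GapRegime.E_key`), `Phi_mul_T_pow`,
  `Phi_mul_prod_T_pow : Phi c L (P · ∏_i T_i^{n_i}) = Phi (c − n) L P`.
So `Phi` lets one evaluate the honest coefficient `[g^L] P` through ANY factorisation `P · ∏ T^{n} = Σ (images of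
monomials of another gauge)`, which is how `Families/GapGaugeMove` proves gauge invariance.
Also here (used by `Families/GapGaugeExchange`, `Families/GapGaugeMove`): the chord spans `spanPoly` telescope under any
ring map sending gaps to differences (`map_spanPoly_telescope`), the vertex-weight product lemmas `prod_pairs_weights` /
`prod_pairs_exchange`, `T_i = spanPoly i (M+1) ≠ 0`, and the top/bottom position bookkeeping inside `K = Frac ℤ[g]`
(`ι_spanPoly`, `y_ne_zero`, `y_anchor`, `aeval_spanPoly`), all stated with the position functions passed as arguments.
Standard axioms only.
-/

namespace Summit.KontsevichZagierPeriods.Zeta5Search.Families.Cellular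

namespace GapRegime

open MvPolynomial Finset

/-! ## The functional `Phi` -/

section Phi

variable {M : ℕ}

/-- **No denominators: `Phi 0 L` is the coefficient of `g^L`.** -/
theorem Phi_zero_eq_coeff (L : Fin (M + 1) → ℕ) (P : MvPolynomial (Fin (M + 1)) ℤ) :
    Phi M 0 L P = coeff (Finsupp.equivFunOnFinite.symm L) P := by
  induction P using MvPolynomial.induction_on' with
  | monomial d r =>
    classical
    rw [Phi_monomial, E_zero, coeff_monomial]
    have hiff : shift d L = 0 ↔ d = Finsupp.equivFunOnFinite.symm L := by
      constructor
      · intro h; ext i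
        have := congrFun h i; simp only [shift, Pi.zero_apply] at this
        simp only [Finsupp.coe_equivFunOnFinite_symm]; omega
      · intro h; subst h; ext i; simp [shift]
    by_cases h : d = Finsupp.equivFunOnFinite.symm L
    · rw [if_pos (hiff.2 h), if_pos h, mul_one]
    · rw [if_neg (fun h' => h (hiff.1 h')), if_neg h, mul_zero]
  | add P Q hP hQ => rw [map_add, coeff_add, hP, hQ]

/-- Offset shift: `Phi c (L + δ_v) (P · g_v) = Phi c L P`. -/
theorem Phi_mul_X (c : Fin (M + 1) → ℤ) (L : Fin (M + 1) → ℕ) (v : Fin (M + 1)) (P : MvPolynomial (Fin (M + 1)) ℤ) :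
    Phi M c (L + Pi.single v 1) (P * X v) = Phi M c L P := by
  induction P using MvPolynomial.induction_on' with
  | monomial d r =>
    rw [show (monomial d r : MvPolynomial (Fin (M + 1)) ℤ) * X v = monomial (d + Finsupp.single v 1) r by
      rw [X, monomial_mul, mul_one], Phi_monomial, Phi_monomial]
    congr 2
    ext i
    simp only [shift, Finsupp.coe_add, Pi.add_apply, Finsupp.single_apply, Pi.single_apply]
    rcases eq_or_ne i v with h | h
    · subst h; simp
    · simp [h, Ne.symm h]
  | add P Q hP hQ => rw [add_mul, map_add, map_add, hP, hQ]


/-- Offset shift by a whole monomial: `Phi c (L + D) (P · g^D) = Phi c L P`. -/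
theorem Phi_mul_monomial (c : Fin (M + 1) → ℤ) (L : Fin (M + 1) → ℕ) (D : Fin (M + 1) →₀ ℕ)
    (P : MvPolynomial (Fin (M + 1)) ℤ) :
    Phi M c (L + ⇑D) (P * monomial D 1) = Phi M c L P := by
  induction P using MvPolynomial.induction_on' with
  | monomial d r =>
    rw [monomial_mul, mul_one, Phi_monomial, Phi_monomial]
    congr 2
    ext i
    simp only [shift, Finsupp.coe_add, Pi.add_apply]
    push_cast; ring
  | add P Q hP hQ => rw [add_mul, map_add, map_add, hP, hQ]

/-- **KEY LEMMA for `Phi`: multiplying by `T_i` lowers the `i`-th denominator exponent:**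
`Phi c L (P · T_i) = Phi (c − δ_i) L P`. -/
theorem Phi_mul_T (c : Fin (M + 1) → ℤ) (L : Fin (M + 1) → ℕ) (i : Fin (M + 1)) (P : MvPolynomial (Fin (M + 1)) ℤ) :
    Phi M c L (P * T M i) = Phi M (c - δ i) L P := by
  induction P using MvPolynomial.induction_on' with
  | monomial d r =>
    rw [T, Finset.mul_sum, map_sum, Phi_monomial, ← E_key, Finset.mul_sum]
    refine Finset.sum_congr rfl fun j _ => ?_
    by_cases hij : i ≤ j
    · rw [if_pos hij, if_pos hij,
        show (monomial d r : MvPolynomial (Fin (M + 1)) ℤ) * X j = monomial (d + Finsupp.single j 1) r by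
          rw [X, monomial_mul, mul_one], Phi_monomial]
      congr 2
      ext t
      simp only [shift, Finsupp.coe_add, Pi.add_apply, Finsupp.single_apply, Pi.single_apply]
      rcases eq_or_ne t j with h | h
      · subst h; simp; ring
      · simp [h, Ne.symm h]
    · rw [if_neg hij, if_neg hij, mul_zero, map_zero, mul_zero]
  | add P Q hP hQ => rw [add_mul, map_add, map_add, hP, hQ]

/-- Iterated key lemma: `Phi c L (P · T_i^n) = Phi (c − n δ_i) L P`. -/
theorem Phi_mul_T_pow (c : Fin (M + 1) → ℤ) (L : Fin (M + 1) → ℕ) (i : Fin (M + 1)) (n : ℕ)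
    (P : MvPolynomial (Fin (M + 1)) ℤ) :
    Phi M c L (P * T M i ^ n) = Phi M (c - (n : ℤ) • δ i) L P := by
  induction n generalizing c with
  | zero => simp
  | succ n ih =>
    rw [pow_succ, ← mul_assoc, Phi_mul_T, ih]
    have e : c - δ i - (n : ℤ) • δ i = c - ((n + 1 : ℕ) : ℤ) • δ i := by
      ext t; simp only [Pi.sub_apply, Pi.smul_apply, smul_eq_mul]; push_cast; ring
    rw [e]

/-- Iterated key lemma over all suffix sums: `Phi c L (P · ∏_i T_i^{n_i}) = Phi (c − n) L P`. -/
theorem Phi_mul_prod_T_pow (c : Fin (M + 1) → ℤ) (L : Fin (M + 1) → ℕ) (n : Fin (M + 1) → ℕ)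
    (P : MvPolynomial (Fin (M + 1)) ℤ) :
    Phi M c L (P * ∏ i : Fin (M + 1), T M i ^ n i) = Phi M (c - fun i => (n i : ℤ)) L P := by
  classical
  have key : ∀ s : Finset (Fin (M + 1)), ∀ c : Fin (M + 1) → ℤ,
      Phi M c L (P * ∏ i ∈ s, T M i ^ n i) = Phi M (c - ∑ i ∈ s, (n i : ℤ) • δ i) L P := by
    intro s
    induction s using Finset.induction_on with
    | empty => intro c; simp
    | insert i s hi ih =>
      intro c
      rw [Finset.prod_insert hi, mul_comm (T M i ^ n i), ← mul_assoc, Phi_mul_T_pow, ih, Finset.sum_insert hi]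
      have e : c - (n i : ℤ) • δ i - ∑ x ∈ s, (n x : ℤ) • δ x = c - ((n i : ℤ) • δ i + ∑ x ∈ s, (n x : ℤ) • δ x) := by
        ext t; simp only [Pi.sub_apply, Pi.add_apply]; ring
      rw [e]
  rw [key Finset.univ c]
  have e : (c - ∑ i : Fin (M + 1), (n i : ℤ) • δ i) = c - fun i => (n i : ℤ) := by
    ext t
    simp only [Pi.sub_apply, Finset.sum_apply, Pi.smul_apply, Pi.single_apply, smul_eq_mul, mul_ite, mul_one,
      mul_zero, Finset.sum_ite_eq, Finset.mem_univ, if_true]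
  rw [e]

end Phi


variable {M : ℕ}

/-! ## Generic lemmas: telescoping spans and vertex weights -/

/-- Adding one gap to a span. -/
theorem spanPoly_succ (i j : ℕ) (hij : i ≤ j) (hj : j < M + 1) :
    spanPoly M i (j + 1) = spanPoly M i j + X ⟨j, hj⟩ := by
  unfold spanPoly
  have hX : (X ⟨j, hj⟩ : MvPolynomial (Fin (M + 1)) ℤ) =
      ∑ t : Fin (M + 1), if (⟨j, hj⟩ : Fin (M + 1)) = t then X t else 0 := by
    rw [Finset.sum_ite_eq]; simp
  rw [hX, ← Finset.sum_add_distrib]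
  refine Finset.sum_congr rfl fun t _ => ?_
  by_cases h1 : i ≤ t.val ∧ t.val < j
  · rw [if_pos h1, if_pos ⟨h1.1, by omega⟩, if_neg (by intro h; have := congrArg Fin.val h; simp at this; omega),
      add_zero]
  · by_cases h2 : (⟨j, hj⟩ : Fin (M + 1)) = t
    · have hv : t.val = j := by rw [← h2]
      rw [if_neg h1, if_pos h2, if_pos ⟨by omega, by omega⟩, zero_add]
    · have hv : t.val ≠ j := fun h => h2 (Fin.ext h.symm)
      rw [if_neg h1, if_neg h2, if_neg (by omega), add_zero]

/-- The empty span. -/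
theorem spanPoly_self (i : ℕ) : spanPoly M i i = 0 := by
  unfold spanPoly
  exact Finset.sum_eq_zero fun t _ => by rw [if_neg (by omega)]

/-- **Telescoping**: under a ring map sending every gap `g_t` to a difference `f t − f (t+1)`, the span of `{i, j}` goes to
`f i − f j`. -/
theorem map_spanPoly_telescope {S : Type*} [CommRing S] (φ : MvPolynomial (Fin (M + 1)) ℤ →+* S) (f : ℕ → S)
    (hφ : ∀ t : Fin (M + 1), φ (X t) = f t.val - f (t.val + 1)) (i j : ℕ) (hij : i ≤ j) (hj : j ≤ M + 1) :
    φ (spanPoly M i j) = f i - f j := by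
  induction j with
  | zero =>
    have hi : i = 0 := by omega
    subst hi; rw [spanPoly_self, map_zero, sub_self]
  | succ j ih =>
    by_cases hi : i = j + 1
    · subst hi; rw [spanPoly_self, map_zero, sub_self]
    · rw [spanPoly_succ i j (by omega) (by omega), map_add, ih (by omega) (by omega), hφ]
      ring

/-- **Vertex weights**: if every bottom factor is the top factor times the weights of its two endpoints, a product
over pairs picks up each weight to the power of the total multiplicity at that vertex. -/
theorem prod_pairs_weights {S : Type*} [CommMonoid S] (n : ℕ) (b t : ℕ → ℕ → S) (w : ℕ → S) (m : ℕ → ℕ → ℕ)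
    (h : ∀ u v, u < v → v < n → b u v = t u v * w u * w v) :
    (∏ u ∈ range n, ∏ v ∈ range n, if u < v then b u v ^ m u v else 1) =
      (∏ u ∈ range n, ∏ v ∈ range n, if u < v then t u v ^ m u v else 1) *
        ∏ u ∈ range n, w u ^ (∑ v ∈ range n, if u < v then m u v else if v < u then m v u else 0) := by
  have step : ∀ u ∈ range n, ∀ v ∈ range n, (if u < v then b u v ^ m u v else (1 : S)) =
      (if u < v then t u v ^ m u v else 1) * (w u ^ (if u < v then m u v else 0) * w v ^ (if u < v then m u v else 0)) := by
    intro u _ v hv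
    rw [Finset.mem_range] at hv
    by_cases huv : u < v
    · simp only [if_pos huv, h u v huv hv, mul_pow, mul_assoc]
    · simp only [if_neg huv, pow_zero, mul_one]
  rw [Finset.prod_congr rfl fun u hu => Finset.prod_congr rfl fun v hv => step u hu v hv]
  simp only [Finset.prod_mul_distrib]
  congr 1
  rw [Finset.prod_comm (f := fun u v => w v ^ (if u < v then m u v else 0)), ← Finset.prod_mul_distrib]
  refine Finset.prod_congr rfl fun u _ => ?_
  rw [Finset.prod_pow_eq_pow_sum, Finset.prod_pow_eq_pow_sum, ← pow_add, ← Finset.sum_add_distrib]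
  congr 1
  refine Finset.sum_congr rfl fun v _ => ?_
  by_cases h1 : u < v
  · simp only [if_pos h1, if_neg (show ¬ v < u by omega), add_zero]
  · by_cases h2 : v < u
    · simp only [if_neg h1, if_pos h2, zero_add]
    · simp only [if_neg h1, if_neg h2, add_zero]

/-- **Balanced exchange**: with two multiplicity systems `m₁` (chords) and `m₂` (sides) that have the same total
multiplicity at every vertex of weight `≠ 1`, bottom-chords × top-sides = top-chords × bottom-sides. -/
theorem prod_pairs_exchange {S : Type*} [CommMonoid S] (n : ℕ) (b t : ℕ → ℕ → S) (w : ℕ → S) (m₁ m₂ : ℕ → ℕ → ℕ)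
    (h : ∀ u v, u < v → v < n → b u v = t u v * w u * w v)
    (hbal : ∀ u < n, w u = 1 ∨
      (∑ v ∈ range n, if u < v then m₁ u v else if v < u then m₁ v u else 0) =
        (∑ v ∈ range n, if u < v then m₂ u v else if v < u then m₂ v u else 0)) :
    (∏ u ∈ range n, ∏ v ∈ range n, if u < v then b u v ^ m₁ u v else 1) *
        (∏ u ∈ range n, ∏ v ∈ range n, if u < v then t u v ^ m₂ u v else 1) =
      (∏ u ∈ range n, ∏ v ∈ range n, if u < v then t u v ^ m₁ u v else 1) *
        (∏ u ∈ range n, ∏ v ∈ range n, if u < v then b u v ^ m₂ u v else 1) := by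
  rw [prod_pairs_weights n b t w m₁ h, prod_pairs_weights n b t w m₂ h]
  have hw : (∏ u ∈ range n, w u ^ (∑ v ∈ range n, if u < v then m₁ u v else if v < u then m₁ v u else 0)) =
      ∏ u ∈ range n, w u ^ (∑ v ∈ range n, if u < v then m₂ u v else if v < u then m₂ v u else 0) := by
    refine Finset.prod_congr rfl fun u hu => ?_
    rcases hbal u (Finset.mem_range.1 hu) with h1 | h1
    · rw [h1, one_pow, one_pow]
    · rw [h1]
  rw [hw]
  simp only [mul_comm, mul_left_comm]

/-! ## Span bookkeeping in `ℤ[g]` -/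

/-- The suffix sum is a span to the anchor: `T_i = spanPoly i (M+1)`. -/
theorem T_eq_spanPoly (i : Fin (M + 1)) : T M i = spanPoly M i.val (M + 1) := by
  unfold T spanPoly
  refine Finset.sum_congr rfl fun t _ => ?_
  by_cases h : i ≤ t
  · rw [if_pos h, if_pos ⟨Fin.le_def.1 h, t.isLt⟩]
  · rw [if_neg h, if_neg (fun h' => h (Fin.le_def.2 h'.1))]

/-- Removing the first gap of a span to the anchor: `spanPoly t (M+1) = g_t + spanPoly (t+1) (M+1)`. -/
theorem spanPoly_anchor_succ (t : Fin (M + 1)) :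
    spanPoly M t.val (M + 1) = X t + spanPoly M (t.val + 1) (M + 1) := by
  unfold spanPoly
  have hX : (X t : MvPolynomial (Fin (M + 1)) ℤ) = ∑ s : Fin (M + 1), if t = s then X s else 0 := by
    rw [Finset.sum_ite_eq]; simp
  rw [hX, ← Finset.sum_add_distrib]
  refine Finset.sum_congr rfl fun s _ => ?_
  by_cases h1 : t = s
  · subst h1
    rw [if_pos ⟨le_refl _, t.isLt⟩, if_pos rfl, if_neg (by omega), add_zero]
  · have hv : t.val ≠ s.val := fun h => h1 (Fin.ext h)
    by_cases h2 : t.val ≤ s.val ∧ s.val < M + 1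
    · rw [if_pos h2, if_neg h1, if_pos ⟨by omega, h2.2⟩, zero_add]
    · rw [if_neg h2, if_neg h1, if_neg (by omega), zero_add]

/-- Spans beyond the anchor vanish: `spanPoly k (M+1) = 0` for `k ≥ M+1`. -/
theorem spanPoly_anchor_of_le (k : ℕ) (hk : M + 1 ≤ k) : spanPoly M k (M + 1) = 0 := by
  unfold spanPoly
  exact Finset.sum_eq_zero fun t _ => by rw [if_neg (by omega)]

/-- `T_i ≠ 0` (its `g_i`-coefficient is `1`). -/
theorem T_ne_zero (i : Fin (M + 1)) : T M i ≠ 0 := by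
  classical
  intro h
  have hc : coeff (Finsupp.single i 1) (T M i) = 1 := by
    unfold T
    rw [coeff_sum, Finset.sum_eq_single i]
    · rw [if_pos (le_refl _), coeff_X_same]
    · intro j _ hj
      by_cases hij : i ≤ j
      · rw [if_pos hij, coeff_X, if_neg (fun h' => hj (Finsupp.single_left_injective one_ne_zero h'))]
      · rw [if_neg hij, coeff_zero]
    · intro hi; exact absurd (Finset.mem_univ i) hi
  rw [h, coeff_zero] at hc
  exact zero_ne_one hc

/-! ## The two gauges inside `K = Frac ℤ[g₀,…,g_M]`

We work with any injective ring map `ι : ℤ[g] → K` into a field (in `Families/GapGaugeMove`: `K = Frac ℤ[g]`) and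
pass the position functions as arguments with their defining equations (no auxiliary definitions):
`y k = ι (spanPoly k (M+1))` (top positions: `y t = ι T_t` for `t ≤ M`, `y (M+1) = 0`), `z 0 = 0`, `z (t+1) = −(y t)⁻¹`
(bottom positions), `h s = z s − z (s+1)` (bottom gaps). -/

section InK

variable {K : Type*} [Field K] (ι : MvPolynomial (Fin (M + 1)) ℤ →+* K) (hι : Function.Injective ι)
  (y z : ℕ → K) (h : Fin (M + 1) → K)
  (hy : ∀ k, y k = ι (spanPoly M k (M + 1)))
  (hz0 : z 0 = 0) (hz : ∀ t : Fin (M + 1), z (t.val + 1) = -(y t.val)⁻¹)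
  (hh : ∀ s : Fin (M + 1), h s = z s.val - z (s.val + 1))

include hy in
/-- Top positions: `ι (spanPoly i j) = y i − y j` for `i ≤ j ≤ M+1`. -/
theorem ι_spanPoly (i j : ℕ) (hij : i ≤ j) (hj : j ≤ M + 1) : ι (spanPoly M i j) = y i - y j := by
  refine map_spanPoly_telescope ι y (fun t => ?_) i j hij hj
  rw [hy, hy, ← map_sub, spanPoly_anchor_succ t, add_sub_cancel_right]

include hy in
/-- Top positions at finite points: `y t = ι T_t` (`t ≤ M`), hence `y t ≠ 0`. -/
theorem y_eq_T (t : Fin (M + 1)) : y t.val = ι (T M t) := by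
  rw [hy, T_eq_spanPoly]

include hy hι in
/-- Top positions at finite points are non-zero (`ι` injective). -/
theorem y_ne_zero (t : Fin (M + 1)) : y t.val ≠ 0 := by
  rw [y_eq_T ι y hy]
  exact fun h0 => T_ne_zero t (hι (by rw [h0, map_zero]))

include hy in
/-- The anchor sits at `0`: `y (M+1) = 0`. -/
theorem y_anchor : y (M + 1) = 0 := by
  rw [hy, spanPoly_anchor_of_le (M + 1) (le_refl _), map_zero]

include hh in
/-- Bottom positions: `aeval h (spanPoly u v) = z u − z v` for `u ≤ v ≤ M+1`. -/
theorem aeval_spanPoly (u v : ℕ) (huv : u ≤ v) (hv : v ≤ M + 1) :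
    MvPolynomial.aeval h (spanPoly M u v) = z u - z v := by
  refine map_spanPoly_telescope (MvPolynomial.aeval h).toRingHom z (fun t => ?_) u v huv hv
  show MvPolynomial.aeval h (X t) = _
  rw [MvPolynomial.aeval_X, hh]

end InK

end GapRegime

end Summit.KontsevichZagierPeriods.Zeta5Search.Families.Cellular
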